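import Summits.QuantumFields.YangMills.Theorems.ParabolicTrajectoryContinuumLimitOnTrajectoryDefs

/-!
# Route `ParabolicTrajectory`, crux `ContinuumLimitOnTrajectory` (stmt-QuantumFields-10522):
# stub `stub_sync` of line `two-orbit-synchronisation`

The abstract two-orbit synchronisation lemma `TwoOrbitSync` (robust lossy form, reversed index): a
two-point boundary-value system of difference inequalities
`a (i+1) ≤ (1+κ) a i + c₃ b (i+1)` (marginal, backward, loss `1+κ`, `κ ≤ κ₀`) and
`b i ≤ θ b (i+1) + c₁ a (i+1)` (fibre, forward, contraction `θ`) with dominated splitting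
`θ (1+κ₀) < 1` and small loop gain `c₁ c₃ ≤ ε₀` forces
`b 0 ≤ K θ₁ ^ J b J + K c₁ a 0` with constants uniform in `J`, `κ ≤ κ₀`, `c₁`, `c₃`.

Proof: with `L = 1 + κ₀`, `s = 1 - θ L ∈ (0, 1]`, `θ₁ = (2 - s)/(2L)`, `Q = 2/s`, `ε₀ = s²/(16 L)`,
`Λ = L (1 + s/4)`, `K = 8 L / s`, induction on `J` of the two-part invariant
`b 0 ≤ θ₁^J b J + K (1 - θ₁^J Λ^J) c₁ a 0` and `a J ≤ Λ^J a 0 + Q c₃ b J`.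
Pure real analysis (Mathlib only).
-/

set_option autoImplicit false

namespace Summit.QuantumFields.YangMills.Cruxes.ContinuumLimitOnTrajectory.TwoOrbitSynchronisation

/-- One step of the synchronisation induction, the fibre bound `(*)`: from the invariant
`aJ ≤ p A + Q c₃ bJ`, the marginal step `a' ≤ L aJ + c₃ b'` and the fibre step `bJ ≤ θ b' + c₁ a'`
deduce `bJ ≤ θ₁ b' + 2 c₁ L p A`, provided `L Q ε₀ ≤ x ≤ 1/2` and `θ + ε₀ + θ₁ x ≤ θ₁`. -/
private theorem step_fibre {θ θ₁ ε₀ x L Q c₁ c₃ p A aJ a' bJ b' : ℝ}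
    (hθ₁ : 0 ≤ θ₁) (hL : 0 ≤ L) (hQ : 0 ≤ Q) (hc₁ : 0 ≤ c₁) (hp : 0 ≤ p) (hA : 0 ≤ A)
    (hb' : 0 ≤ b')
    (hcc : c₁ * c₃ ≤ ε₀) (hx : L * Q * ε₀ ≤ x) (hx2 : x ≤ 1 / 2) (hC2 : θ + ε₀ + θ₁ * x ≤ θ₁)
    (hii : aJ ≤ p * A + Q * c₃ * bJ) (hM : a' ≤ L * aJ + c₃ * b') (hF : bJ ≤ θ * b' + c₁ * a') :
    bJ ≤ θ₁ * b' + 2 * c₁ * L * p * A := by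
  have hyx : L * Q * (c₁ * c₃) ≤ x := (mul_le_mul_of_nonneg_left hcc (mul_nonneg hL hQ)).trans hx
  have h1 : (1 - L * Q * (c₁ * c₃)) * bJ ≤ (θ + ε₀) * b' + c₁ * L * p * A := by
    have e1 : c₁ * a' ≤ c₁ * (L * aJ + c₃ * b') := mul_le_mul_of_nonneg_left hM hc₁
    have e2 : c₁ * L * aJ ≤ c₁ * L * (p * A + Q * c₃ * bJ) :=
      mul_le_mul_of_nonneg_left hii (mul_nonneg hc₁ hL)
    have e3 : c₁ * c₃ * b' ≤ ε₀ * b' := mul_le_mul_of_nonneg_right hcc hb'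
    linarith
  have h2 : (θ + ε₀) * b' + c₁ * L * p * A ≤
      (1 - L * Q * (c₁ * c₃)) * (θ₁ * b' + 2 * c₁ * L * p * A) := by
    have e4 : (θ + ε₀) * b' ≤ ((1 - L * Q * (c₁ * c₃)) * θ₁) * b' := by
      apply mul_le_mul_of_nonneg_right _ hb'
      linarith [mul_le_mul_of_nonneg_left hyx hθ₁]
    have e5 : 0 ≤ c₁ * L * p * A := by positivity
    nlinarith [e4, e5]
  have h3 : 0 < 1 - L * Q * (c₁ * c₃) := by linarith
  exact le_of_mul_le_mul_left (h1.trans h2) h3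

/-- The two-part invariant of the synchronisation induction: for nonnegative `a`, `b` satisfying the
first `J` marginal and fibre inequalities,
`b 0 ≤ θ₁^J b J + K (1 - θ₁^J Λ^J) c₁ a 0` and `a J ≤ Λ^J a 0 + Q c₃ b J`. -/
private theorem sync_invariant {θ θ₁ ε₀ x L Q Λ K κ c₁ c₃ : ℝ} (hθ₁ : 0 ≤ θ₁) (hL : 0 ≤ L)
    (hQ0 : 0 ≤ Q) (hc₁ : 0 ≤ c₁) (hc₃ : 0 ≤ c₃) (hcc : c₁ * c₃ ≤ ε₀) (hx : L * Q * ε₀ ≤ x)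
    (hx2 : x ≤ 1 / 2) (hC2 : θ + ε₀ + θ₁ * x ≤ θ₁) (hQ : 1 + L * Q * θ₁ ≤ Q)
    (hΛ : L * (1 + 2 * x) ≤ Λ) (hΛ0 : 0 ≤ Λ) (hK : 2 * L ≤ K * (1 - θ₁ * Λ)) (hκ : 1 + κ ≤ L)
    (a b : ℕ → ℝ) (ha : ∀ i, 0 ≤ a i) (hb : ∀ i, 0 ≤ b i) :
    ∀ J : ℕ, (∀ i, i < J → a (i + 1) ≤ (1 + κ) * a i + c₃ * b (i + 1)) →
      (∀ i, i < J → b i ≤ θ * b (i + 1) + c₁ * a (i + 1)) →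
        b 0 ≤ θ₁ ^ J * b J + K * (1 - θ₁ ^ J * Λ ^ J) * (c₁ * a 0) ∧
          a J ≤ Λ ^ J * a 0 + Q * c₃ * b J := by
  intro J
  induction J with
  | zero =>
    intro _ _
    simp only [pow_zero, one_mul, mul_one, sub_self, mul_zero, zero_mul, add_zero]
    exact ⟨le_rfl, le_add_of_nonneg_right (mul_nonneg (mul_nonneg hQ0 hc₃) (hb 0))⟩
  | succ J ih =>
    intro hM hF
    obtain ⟨h1, h2⟩ :=
      ih (fun i hi => hM i (Nat.lt_succ_of_lt hi)) (fun i hi => hF i (Nat.lt_succ_of_lt hi))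
    have hMJ' : a (J + 1) ≤ L * a J + c₃ * b (J + 1) := by
      have := hM J (Nat.lt_succ_self J)
      nlinarith [mul_le_mul_of_nonneg_right hκ (ha J)]
    have hp : 0 ≤ Λ ^ J := pow_nonneg hΛ0 J
    have ha0 : 0 ≤ a 0 := ha 0
    have star : b J ≤ θ₁ * b (J + 1) + 2 * c₁ * L * Λ ^ J * a 0 :=
      step_fibre hθ₁ hL hQ0 hc₁ hp ha0 (hb (J + 1)) hcc hx hx2 hC2 h2 hMJ'
        (hF J (Nat.lt_succ_self J))
    simp only [pow_succ]
    constructor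
    · have hP : 0 ≤ θ₁ ^ J * Λ ^ J := mul_nonneg (pow_nonneg hθ₁ J) hp
      have e1 : θ₁ ^ J * b J ≤ θ₁ ^ J * (θ₁ * b (J + 1) + 2 * c₁ * L * Λ ^ J * a 0) :=
        mul_le_mul_of_nonneg_left star (pow_nonneg hθ₁ J)
      have e2 : θ₁ ^ J * Λ ^ J * (2 * L) * (c₁ * a 0) ≤
          θ₁ ^ J * Λ ^ J * (K * (1 - θ₁ * Λ)) * (c₁ * a 0) :=
        mul_le_mul_of_nonneg_right (mul_le_mul_of_nonneg_left hK hP) (mul_nonneg hc₁ (ha 0))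
      linarith
    · have e3 : L * a J ≤ L * (Λ ^ J * a 0 + Q * c₃ * b J) := mul_le_mul_of_nonneg_left h2 hL
      have e4 : L * Q * c₃ * b J ≤ L * Q * c₃ * (θ₁ * b (J + 1) + 2 * c₁ * L * Λ ^ J * a 0) :=
        mul_le_mul_of_nonneg_left star (by positivity)
      have e5 : L * Q * (c₁ * c₃) ≤ x := (mul_le_mul_of_nonneg_left hcc (mul_nonneg hL hQ0)).trans hx
      have e6 : L * Q * (c₁ * c₃) * (2 * L * Λ ^ J * a 0) ≤ x * (2 * L * Λ ^ J * a 0) :=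
        mul_le_mul_of_nonneg_right e5 (by positivity)
      have e7 : (1 + L * Q * θ₁) * (c₃ * b (J + 1)) ≤ Q * (c₃ * b (J + 1)) :=
        mul_le_mul_of_nonneg_right hQ (mul_nonneg hc₃ (hb (J + 1)))
      have e8 : L * (1 + 2 * x) * (Λ ^ J * a 0) ≤ Λ * (Λ ^ J * a 0) :=
        mul_le_mul_of_nonneg_right hΛ (mul_nonneg hp (ha 0))
      linarith

/-- **The abstract synchronisation lemma** (body of `TwoOrbitSync`, robust lossy form, reversed index):
for `0 ≤ θ`, `0 ≤ κ₀` with dominated splitting `θ (1 + κ₀) < 1` there are `ε₀ > 0`, `K ≥ 0` and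
`θ₁ ∈ [0, 1)` such that for every loss `κ ≤ κ₀`, feeds `c₁, c₃ ≥ 0` with loop gain `c₁ c₃ ≤ ε₀`, and all
nonnegative sequences with `a (i+1) ≤ (1+κ) a i + c₃ b (i+1)`, `b i ≤ θ b (i+1) + c₁ a (i+1)` (`i < J`),
the terminal fibre difference obeys `b 0 ≤ K θ₁ ^ J b J + K c₁ a 0`. Constants:
`s = 1 - θ (1+κ₀)`, `ε₀ = s² / (16 (1+κ₀))`, `K = 8 (1+κ₀) / s`, `θ₁ = (2 - s) / (2 (1+κ₀))`. -/
theorem twoOrbitSync_main : ∀ θ κ₀ : ℝ, 0 ≤ θ → 0 ≤ κ₀ → θ * (1 + κ₀) < 1 →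
    ∃ ε₀ K θ₁ : ℝ, 0 < ε₀ ∧ 0 ≤ K ∧ 0 ≤ θ₁ ∧ θ₁ < 1 ∧
      ∀ κ c₁ c₃ : ℝ, 0 ≤ κ → κ ≤ κ₀ → 0 ≤ c₁ → 0 ≤ c₃ → c₁ * c₃ ≤ ε₀ →
        ∀ (J : ℕ) (a b : ℕ → ℝ), (∀ i, 0 ≤ a i) → (∀ i, 0 ≤ b i) →
          (∀ i, i < J → a (i + 1) ≤ (1 + κ) * a i + c₃ * b (i + 1)) →
          (∀ i, i < J → b i ≤ θ * b (i + 1) + c₁ * a (i + 1)) →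
            b 0 ≤ K * θ₁ ^ J * b J + K * c₁ * a 0 := by
  intro θ κ₀ hθ hκ₀ hθκ
  obtain ⟨L, hL⟩ : ∃ L : ℝ, L = 1 + κ₀ := ⟨_, rfl⟩
  have hL1 : 1 ≤ L := by rw [hL]; linarith
  have hL0 : 0 < L := by linarith
  have hθL : θ * L < 1 := by rw [hL]; exact hθκ
  obtain ⟨s, hs⟩ : ∃ s : ℝ, s = 1 - θ * L := ⟨_, rfl⟩
  have hs0 : 0 < s := by rw [hs]; linarith
  have hs1 : s ≤ 1 := by rw [hs]; nlinarith
  have hθs : θ * L = 1 - s := by rw [hs]; ring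
  refine ⟨s ^ 2 / (16 * L), 8 * L / s, (2 - s) / (2 * L), by positivity, by positivity,
    div_nonneg (by linarith) (by positivity), (div_lt_one (by positivity)).2 (by linarith), ?_⟩
  intro κ c₁ c₃ _ hκκ₀ hc₁ hc₃ hcc J a b ha hb hM hF
  have hκL : 1 + κ ≤ L := by rw [hL]; linarith
  have hx : L * (2 / s) * (s ^ 2 / (16 * L)) ≤ s / 8 := by
    apply le_of_eq; field_simp; ring
  have hx2 : s / 8 ≤ 1 / 2 := by linarith
  have hC2 : θ + s ^ 2 / (16 * L) + (2 - s) / (2 * L) * (s / 8) ≤ (2 - s) / (2 * L) := by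
    rw [← sub_nonneg]
    have : (2 - s) / (2 * L) - (θ + s ^ 2 / (16 * L) + (2 - s) / (2 * L) * (s / 8)) =
        (16 - 10 * s - 16 * (θ * L)) / (16 * L) := by
      field_simp; ring
    rw [this, hθs]
    exact div_nonneg (by linarith) (by positivity)
  have hQ : 1 + L * (2 / s) * ((2 - s) / (2 * L)) ≤ 2 / s := by
    apply le_of_eq; field_simp; ring
  have hΛ : L * (1 + 2 * (s / 8)) ≤ L * (1 + s / 4) := by apply le_of_eq; ring
  have hΛ0 : 0 ≤ L * (1 + s / 4) := by positivity
  have hK : 2 * L ≤ 8 * L / s * (1 - (2 - s) / (2 * L) * (L * (1 + s / 4))) := by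
    have : 8 * L / s * (1 - (2 - s) / (2 * L) * (L * (1 + s / 4))) = 2 * L + L * s := by
      field_simp; ring
    rw [this]; nlinarith
  obtain ⟨h1, -⟩ := sync_invariant (div_nonneg (by linarith) (by positivity)) hL0.le (by positivity)
    hc₁ hc₃ hcc hx hx2 hC2 hQ hΛ hΛ0 hK hκL a b ha hb J hM hF
  have hK1 : 1 ≤ 8 * L / s := by rw [le_div_iff₀ hs0]; nlinarith
  have hT : 0 ≤ ((2 - s) / (2 * L)) ^ J * b J :=
    mul_nonneg (pow_nonneg (div_nonneg (by linarith) (by positivity)) J) (hb J)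
  have hP : 0 ≤ 8 * L / s * (((2 - s) / (2 * L)) ^ J * (L * (1 + s / 4)) ^ J) * (c₁ * a 0) := by
    have : 0 ≤ 2 - s := by linarith
    have : 0 ≤ a 0 := ha 0
    positivity
  nlinarith [mul_le_mul_of_nonneg_right hK1 hT]

/-- **Stub 1 of line `two-orbit-synchronisation` (registered signature): the abstract synchronisation
lemma `TwoOrbitSync`** — robust lossy form, reversed index; see `twoOrbitSync_main`. -/
theorem stub_sync : TwoOrbitSync := twoOrbitSync_main

end Summit.QuantumFields.YangMills.Cruxes.ContinuumLimitOnTrajectory.TwoOrbitSynchronisation
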